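import Literature.NumberTheory.EllipticCurves.Disegni2020.PAdicBSDRankOneMultiplicative
import Literature.NumberTheory.EllipticCurves.PAdicBSDMultiplicativeRankOne
import Literature.NumberTheory.EllipticCurves.GrossZagierRationalPoint
import HarnessLib

/-!
# Disegni 2020 Thm. 1 / Thm. 4 at `p ‖ N` in analytic rank one: the typing
# `thm1_padicBSD_rankOne_multiplicative` AGAINST the registered pair
# `padicBSD_nonsplitMult_rankOne` / `padicBSD_splitMult_rankOne` — derivations (theorems only)

Topic `Literature/NumberTheory/EllipticCurves` (cluster `Disegni2020`). Proofs companion of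
`Disegni2020.PAdicBSDRankOneMultiplicative` (seat `cc-typer-3`, lane CLASS-CLOSURE of the BSD
rank-`≤ 1` residual programme), written under the lane's DEDUP rule (referee R132.3 / referee-2
R2-72.10 (2), 2026-08-21: ONE printed theorem — Disegni, Kyoto J. Math. 60 (2020), Thm. 4 — was typed by
four seats; the registered PRIMARY typing is the pair
`Literature.NumberTheory.EllipticCurves.Disegni2020.padicBSD_nonsplitMult_rankOne` (registry A185) /
`…padicBSD_splitMult_rankOne` (A186) of `PAdicBSDMultiplicativeRankOne.lean`; the others are to be
DERIVED from it by name). This file records, in the kernel, exactly how the `cc-typer-3` typing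
`thm1_padicBSD_rankOne_multiplicative` (A180 proposed) sits relative to that pair. Nothing new is
asserted: no `def`, no named fact; every hypothesis is a registered named fact or a per-curve datum.

## What is derived, and what is not (honest statement of the logical relation)

* `exists_rat_shaAn_eq_of_analyticRank_eq_one`: in analytic rank one `#Ш_an(E) ∈ ℚ` — from
  Gross–Zagier 1986 Thm. I.(7.3) clause 2 (`GrossZagier1986_thm_I_7_3`: `L'(E,1) = c · Ω · Reg`,
  `c ∈ ℚ^×`) and Gross–Zagier–Kolyvagin (`rank_eq_analyticRank_of_analyticRank_le_one`:
  `rank E(ℚ) = 1`), since `#Ш_an = L'(E,1) · #E(ℚ)_tors² / (Ω · ∏ c_v · Reg) = c · #T² / ∏ c_v`. This is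
  the content `L^*_alg(E,1) ∈ ℚ` that Disegni's `(BSD_p)` presupposes (§3.1, Prop. 2) and that the
  `cc-typer-3` typing PACKAGES as `∃ s : ℚ, shaAn W = s` while the primary pair takes `s` as a datum.
* `nonsplitClause_of_primary`: the NON-SPLIT clause of `thm1_padicBSD_rankOne_multiplicative`
  (display with a unit `u ∈ ℤ_p^×`) follows from A185 (the EXACT identity, multiplier
  `1 - (-1)⁻¹ = 2`) + the rationality above, with `u = 1`. So on the non-split side the `cc-typer-3`
  typing is WEAKER than A185 ∧ GZ ∧ GZK (weaker-than-print flag: the unit `u`).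
* `splitClause_of_primary`: the SPLIT clause of `thm1_padicBSD_rankOne_multiplicative` (Disegni's
  hypothesis (∗): `p ≥ 5` and a second multiplicative prime; display with a unit) follows from A186
  clause 3 + rationality, with `u = 1`, UNDER THE EXTRA HYPOTHESIS `E[p]` irreducible
  (`HasIrreducibleModPGaloisRep p`) that A186 carries (Venerucci's standing hypothesis, flag
  `Dis20-Thm1-split-Venerucci-irred`) and the `cc-typer-3` typing does not (Disegni's Thm. 4 as
  printed lists only (∗)). Hence: on the irreducible locus the `cc-typer-3` split clause is DERIVED;
  off it, neither typing implies the other, and the registry decides which reading of the print is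
  of record (referee-2 R2-72.10 (2): the pair). The class N8/O2 = X11b where the typing is consumed
  (`Summit.…X11b.ClassClosureDisegniLever`) has `E[p]` irreducible by definition, so nothing is lost
  there.
* NOT derivable in the tree (and not attempted): the `cc-typer-3` typing from the pair ALONE (the
  rationality of `#Ш_an` is genuine extra input), and the pair from the `cc-typer-3` typing (the unit
  `u` is not known to be `1`).

## References
* [Disegni2020] D. Disegni, On the p-adic Birch and Swinnerton-Dyer conjecture for elliptic curves
  over number fields, Kyoto J. Math. 60 (2020) 473–510, Thm. 4 (arXiv:1609.02528 pp. 11–13).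
* [GrossZagier1986] B. Gross, D. Zagier, Heegner points and derivatives of L-series, Invent. Math. 84
  (1986), Thm. I.(7.3).
* [Miller2011LMS] R. L. Miller, Proving the Birch and Swinnerton-Dyer conjecture for specific elliptic
  curves of analytic rank zero and one, LMS J. Comput. Math. 14 (2011), §1 (`#Ш_an`).
-/

noncomputable section

open scoped Classical MatrixGroups ModularForm

open CongruenceSubgroup WeierstrassCurve Literature.NumberTheory.EllipticCurves
  Literature.NumberTheory.EllipticCurves.ModularForms
  Literature.NumberTheory.EllipticCurves.SteinWuthrich2013

namespace Literature.NumberTheory.EllipticCurves.Disegni2020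

/-- **`#Ш_an(E) ∈ ℚ` in analytic rank one** (Gross–Zagier 1986 Thm. I.(7.3) clause 2 with
Gross–Zagier–Kolyvagin): for an elliptic `W/ℚ` with `ord_{s=1} L(W,s) = 1` there is `s ∈ ℚ` with
`shaAn W = s`, namely `s = c · #E(ℚ)_tors² / ∏ c_v` for the Gross–Zagier constant `c`
(`L'(E,1) = c · Ω · Reg`). [cite: GrossZagier1986, Thm. I.(7.3) 2) (p. 231)]
[cite: Miller2011LMS, §1 (arXiv:1010.2431 p. 3)] -/
theorem exists_rat_shaAn_eq_of_analyticRank_eq_one (hGZ : GrossZagier1986_thm_I_7_3)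
    (hGZK : rank_eq_analyticRank_of_analyticRank_le_one) (W : WeierstrassCurve ℚ) [W.IsElliptic]
    (hr : W.analyticRank = 1) : ∃ s : ℚ, shaAn W = (s : ℂ) := by
  obtain ⟨hrank, -⟩ := hGZK W (by omega)
  obtain ⟨c, -, hcL⟩ :=
    leadingLCoeff_eq_rat_mul_of_analyticRank_eq_one (W := W) hGZ hr (by omega)
  have hΩ : (W.realPeriodRat : ℂ) ≠ 0 := by exact_mod_cast W.realPeriodRat_pos_holds.ne'
  have hR : (W.regulator : ℂ) ≠ 0 := by exact_mod_cast W.regulator_pos'.ne'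
  refine ⟨c * (W.torsionOrder : ℚ) ^ 2 / W.tamagawaProduct, ?_⟩
  rw [shaAn_def, hcL]
  by_cases hc : (W.tamagawaProduct : ℂ) = 0
  · have hc' : ((W.tamagawaProduct : ℚ) : ℂ) = 0 := by exact_mod_cast hc
    rw [hc, Rat.cast_div, hc']
    push_cast
    simp
  · have hc' : ((W.tamagawaProduct : ℚ) : ℂ) ≠ 0 := by exact_mod_cast hc
    push_cast
    field_simp

/-- **The NON-SPLIT clause of the `cc-typer-3` typing, DERIVED from the registered primary typing
A185** (`padicBSD_nonsplitMult_rankOne`, exact identity with multiplier `1 - (-1)⁻¹ = 2`) together with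
Gross–Zagier rationality (`hGZ`) and GZK (`hGZK`): the display of
`thm1_padicBSD_rankOne_multiplicative.nonsplit` holds with the unit `u = 1`. Same binders as that
projection, `hD` replaced by `(h, hGZ, hGZK)`. [cite: Disegni2020, Thm. 4 (first bullet), Prop. 2]
[cite: GrossZagier1986, Thm. I.(7.3) 2)] -/
theorem nonsplitClause_of_primary (h : padicBSD_nonsplitMult_rankOne)
    (hGZ : GrossZagier1986_thm_I_7_3) (hGZK : rank_eq_analyticRank_of_analyticRank_le_one)
    (W : WeierstrassCurve ℚ) [W.IsElliptic] [W.IsGloballyMinimal] (p : ℕ) [Fact p.Prime]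
    {N : ℕ} [NeZero N] {f : CuspForm (Gamma0 N) 2}
    (hp : p ≠ 2) (hmult : W.HasMultiplicativeReductionAtPrime p) (hr : W.analyticRank = 1)
    (hf : IsNewformOf W f) (ϖ : ℚ) (hϖ : (ϖ : ℝ) * W.realPeriodRat = plusPeriod f)
    (hns : ¬ W.HasSplitMultiplicativeReductionAtPrime p)
    {q : ℚ_[p]} (hq0 : q ≠ 0) (hq1 : ‖q‖ < 1) (hqj : tateJ q = (W.j : ℚ_[p]))
    (L : PowerSeries ℚ_[p]) (hL : IsMultPAdicLFunctionOf f p (-1) L)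
    (Dh : PAdicHeightData W p) (hDh : IsMultCanonical Dh q) :
    ∃ (s : ℚ) (u : ℤ_[p]ˣ), shaAn W = (s : ℂ) ∧
      ((ϖ : ℚ) : ℚ_[p]) * PowerSeries.coeff 1 L * padicLog p (cyclotomicGenerator p) *
          (W.torsionOrder : ℚ_[p]) ^ 2 =
        ((u : ℤ_[p]) : ℚ_[p]) * (2 * ((s : ℚ_[p]) * padicRegulator Dh * W.tamagawaProduct)) := by
  obtain ⟨s, hs⟩ := exists_rat_shaAn_eq_of_analyticRank_eq_one hGZ hGZK W hr
  refine ⟨s, 1, hs, ?_⟩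
  rw [Units.val_one, PadicInt.coe_one, one_mul]
  exact padicBSD_nonsplitMult_rankOne.identity_two h W p hp hmult hns hr hq0 hq1 hqj hf hL hDh hϖ hs

/-- **The SPLIT clause of the `cc-typer-3` typing, DERIVED ON THE IRREDUCIBLE LOCUS from the
registered primary typing A186** (`padicBSD_splitMult_rankOne`, clause 3: exact identity under
Disegni's (∗)) together with Gross–Zagier rationality and GZK: under the EXTRA hypothesis
`E[p]` irreducible (`hirr`, carried by A186 and not by the `cc-typer-3` typing) the display of
`thm1_padicBSD_rankOne_multiplicative.split` holds with `u = 1`. Off the irreducible locus neither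
typing implies the other (module docstring). [cite: Disegni2020, Thm. 4 (second bullet), Prop. 4, Prop. 5]
[cite: Venerucci2015, Thm. D and §1 standing hypotheses] [cite: GrossZagier1986, Thm. I.(7.3) 2)] -/
theorem splitClause_of_primary (h : padicBSD_splitMult_rankOne)
    (hGZ : GrossZagier1986_thm_I_7_3) (hGZK : rank_eq_analyticRank_of_analyticRank_le_one)
    (W : WeierstrassCurve ℚ) [W.IsElliptic] [W.IsGloballyMinimal] (p : ℕ) [Fact p.Prime]
    {N : ℕ} [NeZero N] {f : CuspForm (Gamma0 N) 2}
    (hirr : W.HasIrreducibleModPGaloisRep p) (hr : W.analyticRank = 1)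
    (hf : IsNewformOf W f) (ϖ : ℚ) (hϖ : (ϖ : ℝ) * W.realPeriodRat = plusPeriod f)
    (hp5 : 5 ≤ p) (hm : ∃ (m : ℕ) (_ : Fact m.Prime), m ≠ p ∧ W.HasMultiplicativeReductionAtPrime m)
    (Dq : TateParameterData W p) (L : PowerSeries ℚ_[p]) (hL : IsSplitMultPAdicLFunctionOf f p L)
    (Dh : PAdicHeightData W p) (hDh : IsSplitMultCanonical Dh Dq) :
    ∃ (s : ℚ) (u : ℤ_[p]ˣ), shaAn W = (s : ℂ) ∧
      ((ϖ : ℚ) : ℚ_[p]) * PowerSeries.coeff 2 L * padicLog p (cyclotomicGenerator p) ^ 2 *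
          (W.torsionOrder : ℚ_[p]) ^ 2 =
        ((u : ℤ_[p]) : ℚ_[p]) *
          (LInvariant Dq * ((s : ℚ_[p]) * padicRegulator Dh * W.tamagawaProduct)) := by
  obtain ⟨s, hs⟩ := exists_rat_shaAn_eq_of_analyticRank_eq_one hGZ hGZK W hr
  refine ⟨s, 1, hs, ?_⟩
  rw [Units.val_one, PadicInt.coe_one, one_mul]
  exact (h W p hp5 Dq hirr hr f hf L hL Dh hDh ϖ hϖ s hs).2.2 hm

/-- **On the irreducible locus the whole `cc-typer-3` typing AT A PAIR `(W, p)` is implied by the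
registered pair + GZ + GZK** — both clauses assembled in the exact shape of
`thm1_padicBSD_rankOne_multiplicative` specialised to `W`, `p` (the hypothesis `ϖ ≠ 0` of that
typing is not needed). [cite: Disegni2020, Thm. 4] [cite: GrossZagier1986, Thm. I.(7.3) 2)] -/
theorem at_pair_of_primary_of_irreducible (h₁ : padicBSD_nonsplitMult_rankOne)
    (h₂ : padicBSD_splitMult_rankOne) (hGZ : GrossZagier1986_thm_I_7_3)
    (hGZK : rank_eq_analyticRank_of_analyticRank_le_one)
    (W : WeierstrassCurve ℚ) [W.IsElliptic] [W.IsGloballyMinimal] (p : ℕ) [Fact p.Prime]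
    {N : ℕ} [NeZero N] {f : CuspForm (Gamma0 N) 2} (hirr : W.HasIrreducibleModPGaloisRep p)
    (hp : p ≠ 2) (hmult : W.HasMultiplicativeReductionAtPrime p) (hr : W.analyticRank = 1)
    (hf : IsNewformOf W f) (ϖ : ℚ) (hϖ : (ϖ : ℝ) * W.realPeriodRat = plusPeriod f) :
    (¬ W.HasSplitMultiplicativeReductionAtPrime p →
        ∀ (q : ℚ_[p]), q ≠ 0 → ‖q‖ < 1 → tateJ q = (W.j : ℚ_[p]) →
        ∀ (L : PowerSeries ℚ_[p]), IsMultPAdicLFunctionOf f p (-1) L →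
        ∀ (Dh : PAdicHeightData W p), IsMultCanonical Dh q →
          ∃ (s : ℚ) (u : ℤ_[p]ˣ), shaAn W = (s : ℂ) ∧
            ((ϖ : ℚ) : ℚ_[p]) * PowerSeries.coeff 1 L * padicLog p (cyclotomicGenerator p) *
                (W.torsionOrder : ℚ_[p]) ^ 2 =
              ((u : ℤ_[p]) : ℚ_[p]) * (2 * ((s : ℚ_[p]) * padicRegulator Dh * W.tamagawaProduct))) ∧
      (W.HasSplitMultiplicativeReductionAtPrime p → 5 ≤ p →
        (∃ (m : ℕ) (_ : Fact m.Prime), m ≠ p ∧ W.HasMultiplicativeReductionAtPrime m) →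
        ∀ (Dq : TateParameterData W p) (L : PowerSeries ℚ_[p]), IsSplitMultPAdicLFunctionOf f p L →
        ∀ (Dh : PAdicHeightData W p), IsSplitMultCanonical Dh Dq →
          ∃ (s : ℚ) (u : ℤ_[p]ˣ), shaAn W = (s : ℂ) ∧
            ((ϖ : ℚ) : ℚ_[p]) * PowerSeries.coeff 2 L * padicLog p (cyclotomicGenerator p) ^ 2 *
                (W.torsionOrder : ℚ_[p]) ^ 2 =
              ((u : ℤ_[p]) : ℚ_[p]) *
                (LInvariant Dq * ((s : ℚ_[p]) * padicRegulator Dh * W.tamagawaProduct))) :=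
  ⟨fun hns _ hq0 hq1 hqj L hL Dh hDh =>
      nonsplitClause_of_primary h₁ hGZ hGZK W p hp hmult hr hf ϖ hϖ hns hq0 hq1 hqj L hL Dh hDh,
    fun _ hp5 hm Dq L hL Dh hDh =>
      splitClause_of_primary h₂ hGZ hGZK W p hirr hr hf ϖ hϖ hp5 hm Dq L hL Dh hDh⟩

end Literature.NumberTheory.EllipticCurves.Disegni2020

end
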